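import Summits.CriticalPhenomena.PercolationContinuityZ3.Theorems.PercNearOneGluingNoHeavyLowerTailQ7ThreeRecipeR5
import HarnessLib

/-!
# `NoHeavyLowerTail` (stmt-CriticalPhenomena-4575) — Kozma–Nitzan Question 7 for three relays:
# the `R6` lower bound for the Question-7 slack

Support file (`--supports stmt-CriticalPhenomena-4575`), coupling seat `prim-cplus-coupling` (gen 4); companion of
`…Q7ThreeRecipeR5` (same setting and notation: `μ = prodBernoulli w` on `Fin n`, observer `o`, target `b`, relays
`x, y, z`, `D = {x↮z} ∩ {y↮z}`, `E₁ = {x↮y} ∩ {x↮z}`, `E₂ = {x↮y} ∩ {y↮z}`, `oA = {o↔x} ∪ {o↔y} ∪ {o↔z}`,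
`o₁₂ = {o↔x} ∪ {o↔y}`, `b₁₂ = {x↔b} ∪ {y↔b}`).  No definitions, no named facts, no sorries.

* `q7r6_decomp` — `μ(zb ∩ oA) + μ(D ∩ o₁₂ ∩ b₁₂) ≤ μ(ob ∩ oA) + μ(D ∩ o₁₂ ∩ {x↔y} ∩ zb) + μ(E₂ ∩ oy ∩ (xb ∪ zb)) + μ(E₁ ∩ ox ∩ (yb ∪ zb))`;
* `q7r6_atoms` — the three new set-BHK inequalities (BHK 2006 Thms 1.3/1.4 for vertex sets, tree theorem `stub_bhkSets`):
  `μ(D)·μ(D∩o₁₂∩{x↔y}∩zb) ≤ μ(D∩o₁₂∩{x↔y})·μ(D∩zb)` (the event `{o ∈ C_x ∪ C_y} ∩ {x↔y}` is increasing in `C_x ∪ C_y`),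
  `μ(E₂)·μ(E₂∩oy∩(xb∪zb)) ≤ μ(E₂∩oy)·μ(E₂∩(xb∪zb))`, `μ(E₁)·μ(E₁∩ox∩(yb∪zb)) ≤ μ(E₁∩ox)·μ(E₁∩(yb∪zb))`;
* `q7r6_level1` — with the first atom of `q7r5_atoms`, the denominator-free form of  `pre ≥ R6`,
  `R6 := φ₁₂ μ(D∩b₁₂) − κ̂ μ(D∩zb) − φ₂ μ(E₂∩(xb∪zb)) − φ₁ μ(E₁∩(yb∪zb))`, `κ̂ = μ(o ↔ {x,y}, x↔y | D)`:
  `(μ(ob∩oA) − μ(zb∩oA))·μ(D)μ(E₁)μ(E₂) ≥ [μ(D∩o₁₂)μ(D∩b₁₂) − μ(D∩o₁₂∩xy)μ(D∩zb)]μ(E₁)μ(E₂)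
     − μ(E₂∩oy)μ(E₂∩(xb∪zb))μ(D)μ(E₁) − μ(E₁∩ox)μ(E₁∩(yb∪zb))μ(D)μ(E₂)`.
By exact partition-law computation (seat memo A5-COUPLING-gen4.md) `R6` is the best of the seat's explicit recipes on the ttrl hard set
(the `o`-glued-to-the-least-reliable-relay corner), where Kozma–Nitzan's bound is negative.
[cite: KozmaNitzan2024, Question 7 (p. 36), Lemma 1 (p. 5)] [cite: VandenbergHaggstromKahn2005, Thms 1.3–1.4]
-/

namespace Summit.CriticalPhenomena.PercolationContinuityZ3.Theorems

open MeasureTheory Set Literature.Probability.LatticeModels Literature.Probability.Percolation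
open scoped Classical BigOperators
open Q7ThreeCut Q7ThreeRecipes

noncomputable section

variable {n : ℕ}

/-! ### The cell decomposition -/

/-- **Cell decomposition for the recipe `R6`.**  With the notation of the file header:
`μ({z↔b} ∩ oA) + μ(D ∩ o₁₂ ∩ b₁₂) ≤ μ({o↔b} ∩ oA) + μ(D ∩ o₁₂ ∩ {x↔y} ∩ {z↔b}) + μ(E₂ ∩ {o↔y} ∩ ({x↔b} ∪ {z↔b}))
  + μ(E₁ ∩ {o↔x} ∩ ({y↔b} ∪ {z↔b}))`
(pure case analysis: on `{z↔b} ∩ oA` with `o ↮ b` the observer hangs on `x` or `y`; if `x ↔ y` we are in the second event,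
otherwise in the third or fourth; on `D ∩ o₁₂ ∩ b₁₂` with `o ↮ b` the observer and `b` hang on different separated relays). [folklore] -/
theorem q7r6_decomp (w : Sym2 (Fin n) → unitInterval) (o b x y z : Fin n) :
    (prodBernoulli w).real (openConn z b ∩ (openConn o x ∪ openConn o y ∪ openConn o z)) +
        (prodBernoulli w).real (((openConn x z)ᶜ ∩ (openConn y z)ᶜ) ∩ (openConn o x ∪ openConn o y) ∩
          (openConn x b ∪ openConn y b)) ≤
      (prodBernoulli w).real (openConn o b ∩ (openConn o x ∪ openConn o y ∪ openConn o z)) +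
        (prodBernoulli w).real (((openConn x z)ᶜ ∩ (openConn y z)ᶜ) ∩ (openConn o x ∪ openConn o y) ∩ openConn x y ∩
          openConn z b) +
        (prodBernoulli w).real (((openConn x y)ᶜ ∩ (openConn y z)ᶜ) ∩ openConn o y ∩ (openConn x b ∪ openConn z b)) +
        (prodBernoulli w).real (((openConn x y)ᶜ ∩ (openConn x z)ᶜ) ∩ openConn o x ∩ (openConn y b ∪ openConn z b)) := by
  set μ := prodBernoulli w with hμ
  set oA : Set (BondConfig (Fin n)) := openConn o x ∪ openConn o y ∪ openConn o z with hoA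
  set D : Set (BondConfig (Fin n)) := (openConn x z)ᶜ ∩ (openConn y z)ᶜ with hD
  set Lz : Set (BondConfig (Fin n)) := openConn z b ∩ oA with hLz
  set Lo : Set (BondConfig (Fin n)) := openConn o b ∩ oA with hLo
  set P : Set (BondConfig (Fin n)) := D ∩ (openConn o x ∪ openConn o y) ∩ (openConn x b ∪ openConn y b) with hP
  set N₃ : Set (BondConfig (Fin n)) := D ∩ (openConn o x ∪ openConn o y) ∩ openConn x y ∩ openConn z b with hN₃
  set N₁ : Set (BondConfig (Fin n)) := ((openConn x y)ᶜ ∩ (openConn y z)ᶜ) ∩ openConn o y ∩ (openConn x b ∪ openConn z b) with hN₁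
  set N₂ : Set (BondConfig (Fin n)) := ((openConn x y)ᶜ ∩ (openConn x z)ᶜ) ∩ openConn o x ∩ (openConn y b ∪ openConn z b) with hN₂
  have hdisj : Disjoint Lz P := by
    rw [Set.disjoint_left]
    rintro ω ⟨hzb, -⟩ ⟨⟨⟨hxz, hyz⟩, -⟩, hb⟩
    rcases hb with hxb | hyb
    · exact hxz (conn_trans hxb (conn_symm hzb))
    · exact hyz (conn_trans hyb (conn_symm hzb))
  have hcover : Lz ∪ P ⊆ Lo ∪ N₃ ∪ N₁ ∪ N₂ := by
    intro ω hω
    by_cases hob : ω ∈ (openConn o b : Set (BondConfig (Fin n)))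
    · rcases hω with ⟨-, hoA'⟩ | ⟨⟨-, ho⟩, -⟩
      · exact Or.inl (Or.inl (Or.inl ⟨hob, hoA'⟩))
      · refine Or.inl (Or.inl (Or.inl ⟨hob, ?_⟩))
        rcases ho with h | h
        · exact Or.inl (Or.inl h)
        · exact Or.inl (Or.inr h)
    rcases hω with ⟨hzb, hoA'⟩ | ⟨⟨⟨hxz, hyz⟩, ho⟩, hb⟩
    · have hoz : ω ∉ (openConn o z : Set (BondConfig (Fin n))) := fun h => hob (conn_trans h hzb)
      have ho12 : ω ∈ (openConn o x ∪ openConn o y : Set (BondConfig (Fin n))) := by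
        rcases hoA' with (h | h) | h
        · exact Or.inl h
        · exact Or.inr h
        · exact absurd h hoz
      by_cases hxz : ω ∈ (openConn x z : Set (BondConfig (Fin n)))
      · have hox : ω ∉ (openConn o x : Set (BondConfig (Fin n))) :=
          fun h => hob (conn_trans h (conn_trans hxz hzb))
        have hoy : ω ∈ (openConn o y : Set (BondConfig (Fin n))) := by
          rcases ho12 with h | h
          · exact absurd h hox
          · exact h
        have hxy : ω ∉ (openConn x y : Set (BondConfig (Fin n))) :=
          fun h => hox (conn_trans hoy (conn_symm h))
        have hyz : ω ∉ (openConn y z : Set (BondConfig (Fin n))) :=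
          fun h => hob (conn_trans hoy (conn_trans h hzb))
        exact Or.inl (Or.inr ⟨⟨⟨hxy, hyz⟩, hoy⟩, Or.inr hzb⟩)
      · by_cases hyz : ω ∈ (openConn y z : Set (BondConfig (Fin n)))
        · have hoy : ω ∉ (openConn o y : Set (BondConfig (Fin n))) :=
            fun h => hob (conn_trans h (conn_trans hyz hzb))
          have hox : ω ∈ (openConn o x : Set (BondConfig (Fin n))) := by
            rcases ho12 with h | h
            · exact h
            · exact absurd h hoy
          have hxy : ω ∉ (openConn x y : Set (BondConfig (Fin n))) :=
            fun h => hoy (conn_trans hox h)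
          exact Or.inr ⟨⟨⟨hxy, hxz⟩, hox⟩, Or.inr hzb⟩
        · -- `z` separated from `x, y`
          by_cases hxy : ω ∈ (openConn x y : Set (BondConfig (Fin n)))
          · exact Or.inl (Or.inl (Or.inr ⟨⟨⟨⟨hxz, hyz⟩, ho12⟩, hxy⟩, hzb⟩))
          · rcases ho12 with hox | hoy
            · exact Or.inr ⟨⟨⟨hxy, hxz⟩, hox⟩, Or.inr hzb⟩
            · exact Or.inl (Or.inr ⟨⟨⟨hxy, hyz⟩, hoy⟩, Or.inr hzb⟩)
    · rcases ho with hox | hoy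
      · have hxb : ω ∉ (openConn x b : Set (BondConfig (Fin n))) := fun h => hob (conn_trans hox h)
        have hyb : ω ∈ (openConn y b : Set (BondConfig (Fin n))) := by
          rcases hb with h | h
          · exact absurd h hxb
          · exact h
        have hxy : ω ∉ (openConn x y : Set (BondConfig (Fin n))) :=
          fun h => hxb (conn_trans h hyb)
        exact Or.inr ⟨⟨⟨hxy, hxz⟩, hox⟩, Or.inl hyb⟩
      · have hyb : ω ∉ (openConn y b : Set (BondConfig (Fin n))) := fun h => hob (conn_trans hoy h)
        have hxb : ω ∈ (openConn x b : Set (BondConfig (Fin n))) := by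
          rcases hb with h | h
          · exact h
          · exact absurd h hyb
        have hxy : ω ∉ (openConn x y : Set (BondConfig (Fin n))) :=
          fun h => hyb (conn_trans (conn_symm h) hxb)
        exact Or.inl (Or.inr ⟨⟨⟨hxy, hyz⟩, hoy⟩, Or.inl hxb⟩)
  have hunion : μ.real (Lz ∪ P) = μ.real Lz + μ.real P := measureReal_union hdisj MeasurableSet.of_discrete
  have h1 : μ.real (Lz ∪ P) ≤ μ.real (Lo ∪ N₃ ∪ N₁ ∪ N₂) := measureReal_mono hcover
  have h2 : μ.real (Lo ∪ N₃ ∪ N₁ ∪ N₂) ≤ μ.real (Lo ∪ N₃ ∪ N₁) + μ.real N₂ := measureReal_union_le _ _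
  have h3 : μ.real (Lo ∪ N₃ ∪ N₁) ≤ μ.real (Lo ∪ N₃) + μ.real N₁ := measureReal_union_le _ _
  have h4 : μ.real (Lo ∪ N₃) ≤ μ.real Lo + μ.real N₃ := measureReal_union_le _ _
  linarith

/-! ### The three new BHK atoms -/

/-- **Three set-BHK inequalities** (BHK 2006, Thm 1.4 for vertex sets; `stub_bhkSets`), `x, y, z` distinct:
(1) `μ(D)·μ(D∩o₁₂∩{x↔y}∩{z↔b}) ≤ μ(D∩o₁₂∩{x↔y})·μ(D∩{z↔b})` (sets `{x,y}` and `{z}`; `o₁₂ ∩ {x↔y}` is increasing in `C_x ∪ C_y`);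
(2) `μ(E₂)·μ(E₂∩{o↔y}∩({x↔b}∪{z↔b})) ≤ μ(E₂∩{o↔y})·μ(E₂∩({x↔b}∪{z↔b}))` (sets `{y}` and `{x,z}`);
(3) `μ(E₁)·μ(E₁∩{o↔x}∩({y↔b}∪{z↔b})) ≤ μ(E₁∩{o↔x})·μ(E₁∩({y↔b}∪{z↔b}))` (sets `{x}` and `{y,z}`).
[cite: VandenbergHaggstromKahn2005, Thm 1.4] -/
theorem q7r6_atoms (w : Sym2 (Fin n) → unitInterval) (o b x y z : Fin n) (hxy : x ≠ y) (hxz : x ≠ z) (hyz : y ≠ z) :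
    (prodBernoulli w).real ((openConn x z)ᶜ ∩ (openConn y z)ᶜ) *
        (prodBernoulli w).real (((openConn x z)ᶜ ∩ (openConn y z)ᶜ) ∩ (openConn o x ∪ openConn o y) ∩ openConn x y ∩
          openConn z b) ≤
      (prodBernoulli w).real (((openConn x z)ᶜ ∩ (openConn y z)ᶜ) ∩ (openConn o x ∪ openConn o y) ∩ openConn x y) *
        (prodBernoulli w).real (((openConn x z)ᶜ ∩ (openConn y z)ᶜ) ∩ openConn z b) ∧
    (prodBernoulli w).real ((openConn x y)ᶜ ∩ (openConn y z)ᶜ) *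
        (prodBernoulli w).real (((openConn x y)ᶜ ∩ (openConn y z)ᶜ) ∩ openConn o y ∩ (openConn x b ∪ openConn z b)) ≤
      (prodBernoulli w).real (((openConn x y)ᶜ ∩ (openConn y z)ᶜ) ∩ openConn o y) *
        (prodBernoulli w).real (((openConn x y)ᶜ ∩ (openConn y z)ᶜ) ∩ (openConn x b ∪ openConn z b)) ∧
    (prodBernoulli w).real ((openConn x y)ᶜ ∩ (openConn x z)ᶜ) *
        (prodBernoulli w).real (((openConn x y)ᶜ ∩ (openConn x z)ᶜ) ∩ openConn o x ∩ (openConn y b ∪ openConn z b)) ≤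
      (prodBernoulli w).real (((openConn x y)ᶜ ∩ (openConn x z)ᶜ) ∩ openConn o x) *
        (prodBernoulli w).real (((openConn x y)ᶜ ∩ (openConn x z)ᶜ) ∩ (openConn y b ∪ openConn z b)) := by
  set μ := prodBernoulli w with hμ
  obtain ⟨-, h14⟩ := stub_bhkSets
  set F12 : Set (Sym2 (Fin n)) → ℝ := (openConn x o ∪ openConn y o : Set (BondConfig (Fin n))).indicator 1 with hF12
  set J : Set (Sym2 (Fin n)) → ℝ := (openConn x y : Set (BondConfig (Fin n))).indicator 1 with hJ
  set Hz : Set (Sym2 (Fin n)) → ℝ := (openConn z b : Set (BondConfig (Fin n))).indicator 1 with hHz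
  set Fy : Set (Sym2 (Fin n)) → ℝ := (openConn y o : Set (BondConfig (Fin n))).indicator 1 with hFy
  set Fx : Set (Sym2 (Fin n)) → ℝ := (openConn x o : Set (BondConfig (Fin n))).indicator 1 with hFx
  set Gxz : Set (Sym2 (Fin n)) → ℝ := (openConn x b ∪ openConn z b : Set (BondConfig (Fin n))).indicator 1 with hGxz
  set Gyz : Set (Sym2 (Fin n)) → ℝ := (openConn y b ∪ openConn z b : Set (BondConfig (Fin n))).indicator 1 with hGyz
  have hup12o : IsUpperSet (openConn x o ∪ openConn y o : Set (BondConfig (Fin n))) :=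
    (isUpperSet_openConn x o).union (isUpperSet_openConn y o)
  have hF12m : Monotone F12 := monotone_indicator_of_isUpperSet hup12o
  have hJm : Monotone J := monotone_indicator_of_isUpperSet (isUpperSet_openConn x y)
  have hF12J : Monotone (fun E => F12 E * J E) :=
    hF12m.mul hJm (fun E => indicator_nonneg (fun _ _ => zero_le_one) E) (fun E => indicator_nonneg (fun _ _ => zero_le_one) E)
  have hHzm : Monotone Hz := monotone_indicator_of_isUpperSet (isUpperSet_openConn z b)
  have hFym : Monotone Fy := monotone_indicator_of_isUpperSet (isUpperSet_openConn y o)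
  have hFxm : Monotone Fx := monotone_indicator_of_isUpperSet (isUpperSet_openConn x o)
  have hGxzm : Monotone Gxz := monotone_indicator_of_isUpperSet ((isUpperSet_openConn x b).union (isUpperSet_openConn z b))
  have hGyzm : Monotone Gyz := monotone_indicator_of_isUpperSet ((isUpperSet_openConn y b).union (isUpperSet_openConn z b))
  have hxo : (openConn x o : Set (BondConfig (Fin n))) = openConn o x := by
    ext η; exact ⟨fun h => SimpleGraph.Reachable.symm h, fun h => SimpleGraph.Reachable.symm h⟩
  have hyo : (openConn y o : Set (BondConfig (Fin n))) = openConn o y := by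
    ext η; exact ⟨fun h => SimpleGraph.Reachable.symm h, fun h => SimpleGraph.Reachable.symm h⟩
  have h12o : (openConn x o ∪ openConn y o : Set (BondConfig (Fin n))) = openConn o x ∪ openConn o y := by rw [hxo, hyo]
  have hCxy : ∀ ω : BondConfig (Fin n), (⋃ s ∈ ({x, y} : Finset (Fin n)), openEdgeCluster ω s) =
      openEdgeCluster ω x ∪ openEdgeCluster ω y := by
    intro ω; rw [Finset.set_biUnion_insert, Finset.set_biUnion_singleton]
  have hCxz : ∀ ω : BondConfig (Fin n), (⋃ s ∈ ({x, z} : Finset (Fin n)), openEdgeCluster ω s) =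
      openEdgeCluster ω x ∪ openEdgeCluster ω z := by
    intro ω; rw [Finset.set_biUnion_insert, Finset.set_biUnion_singleton]
  have hCyz : ∀ ω : BondConfig (Fin n), (⋃ s ∈ ({y, z} : Finset (Fin n)), openEdgeCluster ω s) =
      openEdgeCluster ω y ∪ openEdgeCluster ω z := by
    intro ω; rw [Finset.set_biUnion_insert, Finset.set_biUnion_singleton]
  have hCx : ∀ ω : BondConfig (Fin n), (⋃ s ∈ ({x} : Finset (Fin n)), openEdgeCluster ω s) = openEdgeCluster ω x :=
    fun ω => Finset.set_biUnion_singleton x _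
  have hCy : ∀ ω : BondConfig (Fin n), (⋃ s ∈ ({y} : Finset (Fin n)), openEdgeCluster ω s) = openEdgeCluster ω y :=
    fun ω => Finset.set_biUnion_singleton y _
  have hCz : ∀ ω : BondConfig (Fin n), (⋃ s ∈ ({z} : Finset (Fin n)), openEdgeCluster ω s) = openEdgeCluster ω z :=
    fun ω => Finset.set_biUnion_singleton z _
  have sub2 : ∀ (ω : BondConfig (Fin n)) (s t : Fin n), openEdgeCluster ω s ∪ openEdgeCluster ω t ⊆ ω :=
    fun ω s t => union_subset (openEdgeCluster_subset ω s) (openEdgeCluster_subset ω t)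
  have eF12 : ∀ ω : BondConfig (Fin n), F12 (openEdgeCluster ω x ∪ openEdgeCluster ω y) =
      (openConn o x ∪ openConn o y : Set (BondConfig (Fin n))).indicator 1 ω := by
    intro ω; rw [hF12, indicator_union_openConn_of_clusters subset_union_left subset_union_right (sub2 ω x y), h12o]
  have eJ : ∀ ω : BondConfig (Fin n), J (openEdgeCluster ω x ∪ openEdgeCluster ω y) =
      (openConn x y : Set (BondConfig (Fin n))).indicator 1 ω := fun ω =>
    indicator_openConn_of_cluster_subset subset_union_left (sub2 ω x y)
  have eHz : ∀ ω : BondConfig (Fin n), Hz (openEdgeCluster ω z) = (openConn z b : Set (BondConfig (Fin n))).indicator 1 ω :=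
    fun ω => indicator_openConn_of_cluster_subset subset_rfl (openEdgeCluster_subset ω z)
  have eFy : ∀ ω : BondConfig (Fin n), Fy (openEdgeCluster ω y) = (openConn o y : Set (BondConfig (Fin n))).indicator 1 ω := by
    intro ω; rw [hFy, indicator_openConn_of_cluster_subset subset_rfl (openEdgeCluster_subset ω y), hyo]
  have eFx : ∀ ω : BondConfig (Fin n), Fx (openEdgeCluster ω x) = (openConn o x : Set (BondConfig (Fin n))).indicator 1 ω := by
    intro ω; rw [hFx, indicator_openConn_of_cluster_subset subset_rfl (openEdgeCluster_subset ω x), hxo]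
  have eGxz : ∀ ω : BondConfig (Fin n), Gxz (openEdgeCluster ω x ∪ openEdgeCluster ω z) =
      (openConn x b ∪ openConn z b : Set (BondConfig (Fin n))).indicator 1 ω := fun ω =>
    indicator_union_openConn_of_clusters subset_union_left subset_union_right (sub2 ω x z)
  have eGyz : ∀ ω : BondConfig (Fin n), Gyz (openEdgeCluster ω y ∪ openEdgeCluster ω z) =
      (openConn y b ∪ openConn z b : Set (BondConfig (Fin n))).indicator 1 ω := fun ω =>
    indicator_union_openConn_of_clusters subset_union_left subset_union_right (sub2 ω y z)
  have prod_ind : ∀ (A B : Set (BondConfig (Fin n))) (ω : BondConfig (Fin n)),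
      A.indicator (1 : BondConfig (Fin n) → ℝ) ω * B.indicator 1 ω = (A ∩ B).indicator 1 ω := fun A B ω =>
    (congrFun (inter_indicator_one (s := A) (t := B) (M₀ := ℝ)) ω).symm
  have hDfin : {ω : BondConfig (Fin n) | ∀ s ∈ ({x, y} : Finset (Fin n)), ∀ t ∈ ({z} : Finset (Fin n)),
      ¬ (openGraph ω).Reachable s t} = (openConn x z)ᶜ ∩ (openConn y z)ᶜ := by
    ext ω
    simp only [mem_setOf_eq, Finset.mem_insert, Finset.mem_singleton, forall_eq_or_imp, forall_eq,
      mem_inter_iff, mem_compl_iff]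
    rfl
  have hE2fin : {ω : BondConfig (Fin n) | ∀ s ∈ ({y} : Finset (Fin n)), ∀ t ∈ ({x, z} : Finset (Fin n)),
      ¬ (openGraph ω).Reachable s t} = (openConn x y)ᶜ ∩ (openConn y z)ᶜ := by
    ext ω
    simp only [mem_setOf_eq, Finset.mem_singleton, forall_eq, Finset.mem_insert, forall_eq_or_imp,
      mem_inter_iff, mem_compl_iff]
    exact and_congr (not_congr ⟨SimpleGraph.Reachable.symm, SimpleGraph.Reachable.symm⟩) Iff.rfl
  have hE1fin : {ω : BondConfig (Fin n) | ∀ s ∈ ({x} : Finset (Fin n)), ∀ t ∈ ({y, z} : Finset (Fin n)),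
      ¬ (openGraph ω).Reachable s t} = (openConn x y)ᶜ ∩ (openConn x z)ᶜ := by
    ext ω
    simp only [mem_setOf_eq, Finset.mem_singleton, forall_eq, Finset.mem_insert, forall_eq_or_imp,
      mem_inter_iff, mem_compl_iff]
    rfl
  refine ⟨?_, ?_, ?_⟩
  · have key := h14 n w {x, y} {z} (fun E => F12 E * J E) Hz hF12J hHzm (by
      simp only [Finset.disjoint_insert_left, Finset.mem_singleton, Finset.disjoint_singleton_left]
      exact ⟨hxz, hyz⟩)
    simp only [hDfin, hCxy, hCz] at key
    simp only [eF12, eJ, eHz, prod_ind, setIntegral_indicator_one_eq] at key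
    simpa only [inter_assoc] using key
  · have key := h14 n w {y} {x, z} Fy Gxz hFym hGxzm (by
      simp only [Finset.disjoint_singleton_left, Finset.mem_insert, Finset.mem_singleton, not_or]
      exact ⟨Ne.symm hxy, hyz⟩)
    simp only [hE2fin, hCy, hCxz] at key
    simp only [eFy, eGxz, prod_ind, setIntegral_indicator_one_eq] at key
    simpa only [inter_assoc] using key
  · have key := h14 n w {x} {y, z} Fx Gyz hFxm hGyzm (by
      simp only [Finset.disjoint_singleton_left, Finset.mem_insert, Finset.mem_singleton, not_or]
      exact ⟨hxy, hxz⟩)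
    simp only [hE1fin, hCx, hCyz] at key
    simp only [eFx, eGyz, prod_ind, setIntegral_indicator_one_eq] at key
    simpa only [inter_assoc] using key

/-! ### Level 1: `pre ≥ R6` in denominator-free form -/

/-- **The `R6` lower bound for the Question-7 slack (denominator-free).**  For distinct relays `x, y, z`:
`(μ(ob ∩ oA) − μ(zb ∩ oA))·μ(D)μ(E₁)μ(E₂) ≥ [μ(D∩o₁₂)μ(D∩b₁₂) − μ(D∩o₁₂∩{x↔y})μ(D∩{z↔b})]·μ(E₁)μ(E₂)
  − μ(E₂∩{o↔y})μ(E₂∩({x↔b}∪{z↔b}))·μ(D)μ(E₁) − μ(E₁∩{o↔x})μ(E₁∩({y↔b}∪{z↔b}))·μ(D)μ(E₂)`,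
i.e. `pre ≥ φ₁₂ μ(D∩b₁₂) − κ̂ μ(D∩zb) − φ₂ μ(E₂∩(xb∪zb)) − φ₁ μ(E₁∩(yb∪zb))` (`κ̂ = μ(o↔{x,y}, x↔y | D)`).
Proof: `q7r6_decomp`, the first atom of `q7r5_atoms`, and `q7r6_atoms`.
[cite: KozmaNitzan2024, Question 7 (p. 36)] [cite: VandenbergHaggstromKahn2005, Thms 1.3–1.4] -/
theorem q7r6_level1 (w : Sym2 (Fin n) → unitInterval) (o b x y z : Fin n) (hxy : x ≠ y) (hxz : x ≠ z) (hyz : y ≠ z) :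
    ((prodBernoulli w).real (((openConn x z)ᶜ ∩ (openConn y z)ᶜ) ∩ (openConn o x ∪ openConn o y)) *
            (prodBernoulli w).real (((openConn x z)ᶜ ∩ (openConn y z)ᶜ) ∩ (openConn x b ∪ openConn y b)) -
          (prodBernoulli w).real (((openConn x z)ᶜ ∩ (openConn y z)ᶜ) ∩ (openConn o x ∪ openConn o y) ∩ openConn x y) *
            (prodBernoulli w).real (((openConn x z)ᶜ ∩ (openConn y z)ᶜ) ∩ openConn z b)) *
          (prodBernoulli w).real ((openConn x y)ᶜ ∩ (openConn x z)ᶜ) *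
          (prodBernoulli w).real ((openConn x y)ᶜ ∩ (openConn y z)ᶜ) -
        (prodBernoulli w).real (((openConn x y)ᶜ ∩ (openConn y z)ᶜ) ∩ openConn o y) *
          (prodBernoulli w).real (((openConn x y)ᶜ ∩ (openConn y z)ᶜ) ∩ (openConn x b ∪ openConn z b)) *
          (prodBernoulli w).real ((openConn x z)ᶜ ∩ (openConn y z)ᶜ) *
          (prodBernoulli w).real ((openConn x y)ᶜ ∩ (openConn x z)ᶜ) -
        (prodBernoulli w).real (((openConn x y)ᶜ ∩ (openConn x z)ᶜ) ∩ openConn o x) *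
          (prodBernoulli w).real (((openConn x y)ᶜ ∩ (openConn x z)ᶜ) ∩ (openConn y b ∪ openConn z b)) *
          (prodBernoulli w).real ((openConn x z)ᶜ ∩ (openConn y z)ᶜ) *
          (prodBernoulli w).real ((openConn x y)ᶜ ∩ (openConn y z)ᶜ) ≤
      ((prodBernoulli w).real (openConn o b ∩ (openConn o x ∪ openConn o y ∪ openConn o z)) -
          (prodBernoulli w).real (openConn z b ∩ (openConn o x ∪ openConn o y ∪ openConn o z))) *
        (prodBernoulli w).real ((openConn x z)ᶜ ∩ (openConn y z)ᶜ) *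
        (prodBernoulli w).real ((openConn x y)ᶜ ∩ (openConn x z)ᶜ) *
        (prodBernoulli w).real ((openConn x y)ᶜ ∩ (openConn y z)ᶜ) := by
  obtain ⟨a1, -, -, -⟩ := q7r5_atoms w o b x y z hxy hxz hyz
  obtain ⟨a2, a3, a4⟩ := q7r6_atoms w o b x y z hxy hxz hyz
  have dec := q7r6_decomp w o b x y z
  set μ := prodBernoulli w with hμ
  set pD := μ.real ((openConn x z)ᶜ ∩ (openConn y z)ᶜ) with hpD
  set pE1 := μ.real ((openConn x y)ᶜ ∩ (openConn x z)ᶜ) with hpE1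
  set pE2 := μ.real ((openConn x y)ᶜ ∩ (openConn y z)ᶜ) with hpE2
  set oD := μ.real (((openConn x z)ᶜ ∩ (openConn y z)ᶜ) ∩ (openConn o x ∪ openConn o y)) with hoD
  set b12 := μ.real (((openConn x z)ᶜ ∩ (openConn y z)ᶜ) ∩ (openConn x b ∪ openConn y b)) with hb12
  set kD := μ.real (((openConn x z)ᶜ ∩ (openConn y z)ᶜ) ∩ (openConn o x ∪ openConn o y) ∩ openConn x y) with hkD
  set b3 := μ.real (((openConn x z)ᶜ ∩ (openConn y z)ᶜ) ∩ openConn z b) with hb3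
  set P := μ.real (((openConn x z)ᶜ ∩ (openConn y z)ᶜ) ∩ (openConn o x ∪ openConn o y) ∩
    (openConn x b ∪ openConn y b)) with hP
  set N3 := μ.real (((openConn x z)ᶜ ∩ (openConn y z)ᶜ) ∩ (openConn o x ∪ openConn o y) ∩ openConn x y ∩ openConn z b)
    with hN3
  set o2 := μ.real (((openConn x y)ᶜ ∩ (openConn y z)ᶜ) ∩ openConn o y) with ho2
  set g2 := μ.real (((openConn x y)ᶜ ∩ (openConn y z)ᶜ) ∩ (openConn x b ∪ openConn z b)) with hg2
  set N1 := μ.real (((openConn x y)ᶜ ∩ (openConn y z)ᶜ) ∩ openConn o y ∩ (openConn x b ∪ openConn z b)) with hN1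
  set o1 := μ.real (((openConn x y)ᶜ ∩ (openConn x z)ᶜ) ∩ openConn o x) with ho1
  set g1 := μ.real (((openConn x y)ᶜ ∩ (openConn x z)ᶜ) ∩ (openConn y b ∪ openConn z b)) with hg1
  set N2 := μ.real (((openConn x y)ᶜ ∩ (openConn x z)ᶜ) ∩ openConn o x ∩ (openConn y b ∪ openConn z b)) with hN2
  set Lo := μ.real (openConn o b ∩ (openConn o x ∪ openConn o y ∪ openConn o z)) with hLo
  set Lz := μ.real (openConn z b ∩ (openConn o x ∪ openConn o y ∪ openConn o z)) with hLz
  have h0D : 0 ≤ pD := measureReal_nonneg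
  have h0E1 : 0 ≤ pE1 := measureReal_nonneg
  have h0E2 : 0 ≤ pE2 := measureReal_nonneg
  have hPos : 0 ≤ pD * pE1 * pE2 := mul_nonneg (mul_nonneg h0D h0E1) h0E2
  have step0 : (P - N3 - N1 - N2) * (pD * pE1 * pE2) ≤ (Lo - Lz) * (pD * pE1 * pE2) :=
    mul_le_mul_of_nonneg_right (by linarith) hPos
  have s1 : oD * b12 * (pE1 * pE2) ≤ pD * P * (pE1 * pE2) := mul_le_mul_of_nonneg_right a1 (mul_nonneg h0E1 h0E2)
  have s2 : pD * N3 * (pE1 * pE2) ≤ kD * b3 * (pE1 * pE2) := mul_le_mul_of_nonneg_right a2 (mul_nonneg h0E1 h0E2)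
  have s3 : pE2 * N1 * (pD * pE1) ≤ o2 * g2 * (pD * pE1) := mul_le_mul_of_nonneg_right a3 (mul_nonneg h0D h0E1)
  have s4 : pE1 * N2 * (pD * pE2) ≤ o1 * g1 * (pD * pE2) := mul_le_mul_of_nonneg_right a4 (mul_nonneg h0D h0E2)
  nlinarith [step0, s1, s2, s3, s4]

end

end Summit.CriticalPhenomena.PercolationContinuityZ3.Theorems
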